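import Summits.AnomalousDissipation.AnomalousDissipation.Theorems.SolenoidalFractalHomogenisationLagrangianStepSidebandLadderCrush
import Summits.AnomalousDissipation.AnomalousDissipation.Theorems.SolenoidalFractalHomogenisationLagrangianStepLadderHypocoerciveRate
import HarnessLib

/-!
# K1L_D `stub_D1_V0thg` (stmt-AnomalousDissipation-27980), R3′ lane «SidebandTailCrushing» (tenure D28-16 (3) / D28-20 / D28-31) —
# file F4h∘F5: the LADDER CRUSH with the hypocoercivity parameters CHOSEN (four scalar conditions instead of twelve polynomial constraints)

Helper file of route `SolenoidalFractalHomogenisation` (`--supports stmt-AnomalousDissipation-27980 --as helper`; one-generation hand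
`leafhand-ad-solenoidalfractalh-1` g0 on the w1 lineage's road of record E-c: F4h `Sideband.ladder_crush` (p735462) was «closed modulo
ν-plugging», F5 `LadderCrush.hypocoercive_parameters` (p734725) is the parameter bookkeeping; this file is their composition, the step the
planner's FINAL HANDOFF (HOME/ad-ideate-p1/r29/HANDOFF-g29-final.md, (A) road) lists first as `ladder_crush_nu`'s input).
`ladder_crush_param`: in the setting of `Sideband.ladder_crush` (one slot `i` of the word, other envelopes off, envelope in `[Gm, GM]` with
`Gm > 0`, hopping ladder `z₀ + ℤmᵢ` with `êᵢ·z₀ ≠ 0`, box radius `R > M`, `NearIso 𝔸 lo' hi'`, `OddSmall 𝔸 βo`, initial state in the ladder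
subspace), write `a = 2π|êᵢ·z₀|‖αᵢ‖ > 0`, `m₂ = |mᵢ|²`, `lo₁ = 4π²lo'/7`, `S = 4·(4a²) + 16·(8a²(1+m₂)|hi'|/lo') + 1`, `ρ = βo/(2lo')`,
`Mo = 8a²(1+m₂)`, `η₀ = GM·6a²/((R−M)·4π²lo')`, `U₁ = (1+m₂)/(4a²)·(2 + 2a²/ε)`, `U₂ = (1+m₂)/(4a²)·2ε`,
`U₃ = (1+m₂)/(4a²)·(6a²/((R−M)4π²lo') + 4a²/(4π²lo'(R−M)²))`.  Then for every `b, q, ε > 0` with the FOUR scalar conditions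
(Q3) `2S²b³GM² ≤ Gm·lo₁`, (Q4) `16bη₀ ≤ 1`, (Qc) `16ρq(1+Mo) ≤ 1`, (Qd) `8ρ(1+Mo) ≤ Sq`, and every `0 < δ₁ ≤ t₁ − t₀`:
`‖u t₁‖² ≤ 3(1 + Sb²/(2δ₁lo₁))·exp(−lam(t₁−t₀−δ₁))·‖u t₀‖²`, `lam = min(lo₁/(6Sb²), lo₁/(6U₂), 1/(6U₃), 2bGm/(3U₁)) > 0`
(`β = b`, `α = Sb²`, `s = b/q`, `s' = q/b`).  The abbreviations enter as bound variables with defining equations (`rfl` for the consumer).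
What is left for `ladder_crush_nu` (R3′-1 → R3′-2, not here): the window instance `lo' = 10ν/11`, `hi' = 11ν/10`, `βo = ντ·11/10`,
`b = (Gm·lo₁/(2S²GM²))^{1/3} ∝ ν^{1/3}`, `ε ∝ ν^{1/3}`, `R − M ≳ ν^{−2/3}` ⇒ `lam ≳ c·ν^{2/3}` and the slot bookkeeping (crushing factor
`exp(−c′ν^{−1/3})` over a quasi-static slot of length `∝ 1/ν`).  No definitions, no sorry.  NOT a proof of `stub_D1_V0thg`, of K1L_D or of AD;
rung F-D1.A0 infrastructure.
-/

set_option linter.dupNamespace false -- single-conjunct summit: `Summit.AnomalousDissipation.AnomalousDissipation.…` is the mandated namespace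

noncomputable section

namespace Summit.AnomalousDissipation.AnomalousDissipation.Theorems.SolenoidalFractalHomogenisation.LagrangianStep.Sideband

open Set Complex
open scoped InnerProductSpace
open Literature.Analysis Literature.Analysis.FunctionSpaces Literature.Analysis.FunctionSpaces.Torus
open Literature.Analysis.FluidPDE Literature.Analysis.FluidPDE.Torus Literature.Analysis.FluidPDE.LatticeShear

variable {k₀ : ℕ}

set_option maxHeartbeats 400000 in -- pre-budgeted (ops-buildfix rule): large statement, twelve-constraint instantiation
/-- **LADDER CRUSH WITH CHOSEN PARAMETERS** (`Sideband.ladder_crush` ∘ `LadderCrush.hypocoercive_parameters`): hypocoercive decay of a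
solution of the truncated sideband system on a hopping ladder during one slot, from an initial state in the ladder subspace, under
`NearIso`/`OddSmall`, with `β = b`, `α = S b²`, `s = b/q`, `s' = q/b`, `lam = min(lo₁/(6Sb²), lo₁/(6U₂), 1/(6U₃), 2bGm/(3U₁))` and only the
four scalar conditions (Q3) (Q4) (Qc) (Qd) on `b, q` left (see the module docstring for the dictionary of the bound abbreviations).
[cite: BedrossianCotiZelati2017, §2 (hypocoercivity, enhanced dissipation)] [cite: Avron1998OddViscosity, §2 eq. (1)-(2)] -/
theorem ladder_crush_param (W₁ : LatticeWord k₀) {R : ℕ} (i : Fin k₀) (z₀ : Fin 3 → ℤ)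
    (hhop : ∑ a, (W₁.phase i).e a * (z₀ a : ℝ) ≠ 0) {M : ℝ} (hM : ∀ j, |((W₁.phase i).m j : ℝ)| ≤ M) (hMR : M < R)
    {𝔸 : Torus.Visc4 (Fin 3)} {lo' hi' : ℝ} (h𝔸 : Torus.NearIso 𝔸 lo' hi') (hlo' : 0 < lo') (hhi : 0 < hi') {βo : ℝ} (hoddA : Torus.OddSmall 𝔸 βo)
    (hβo : 0 ≤ βo) {γ₁ : ℝ} (hγ₁ : 0 ≤ γ₁)
    {u : ℝ → Space R} {t₀ t₁ δ₁ : ℝ} (hδ : 0 < δ₁) (hδt : t₀ + δ₁ ≤ t₁)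
    (hu : ∀ t ∈ Icc t₀ t₁, HasDerivAt u (((gen W₁ 𝔸 γ₁ R t).restrictScalars ℝ) (u t)) t)
    (h0 : u t₀ ∈ ladderSub R (ladder z₀ (W₁.phase i).m))
    (hoff : ∀ t ∈ Icc t₀ t₁, ∀ j, j ≠ i → slotEnvelope W₁ j t = 0)
    {Gm GM : ℝ} (hG : ∀ t ∈ Icc t₀ t₁, Gm ≤ slotEnvelope W₁ i t ∧ slotEnvelope W₁ i t ≤ GM) (hGm : 0 < Gm)
    -- the bound abbreviations (instantiate with `rfl`)
    {a m₂ lo₁ S ρ Mo η₀ U₁ U₂ U₃ lam : ℝ} (ha0 : 0 < a)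
    (ha : a = 2 * Real.pi * |∑ a, (W₁.phase i).e a * (z₀ a : ℝ)| * ‖slotAmp W₁ i‖)
    (hm₂ : m₂ = freqNormSq (W₁.phase i).m) (hlo₁ : lo₁ = 4 * Real.pi ^ 2 * lo' / 7)
    (hS : S = 4 * (4 * a ^ 2) + 16 * (8 * a ^ 2 * (1 + m₂) * |hi'| / lo') + 1)
    (hρ : ρ = βo / (2 * lo')) (hMo : Mo = 8 * a ^ 2 * (1 + m₂))
    (hη₀ : η₀ = GM * (2 * a ^ 2 * 3 / (((R : ℝ) - M) * (4 * Real.pi ^ 2 * lo'))))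
    {b q ε : ℝ} (hb : 0 < b) (hq : 0 < q) (hε : 0 < ε)
    (hU₁ : U₁ = (1 + m₂) / (4 * a ^ 2) * (2 + 2 * a ^ 2 / ε)) (hU₂ : U₂ = (1 + m₂) / (4 * a ^ 2) * (2 * ε))
    (hU₃ : U₃ = (1 + m₂) / (4 * a ^ 2) * (2 * a ^ 2 * 3 / (((R : ℝ) - M) * (4 * Real.pi ^ 2 * lo')) + 4 * a ^ 2 / (4 * Real.pi ^ 2 * lo' * ((R : ℝ) - M) ^ 2)))
    (hlam : lam = min (lo₁ / (6 * (S * b ^ 2))) (min (lo₁ / (6 * U₂)) (min (1 / (6 * U₃)) (2 * b * Gm / (3 * U₁)))))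
    -- the four scalar conditions
    (Q3 : 2 * S ^ 2 * b ^ 3 * GM ^ 2 ≤ Gm * lo₁) (Q4 : 16 * b * η₀ ≤ 1)
    (Qc : 16 * ρ * q * (1 + Mo) ≤ 1) (Qd : 8 * ρ * (1 + Mo) ≤ S * q) :
    0 < lam ∧ ‖u t₁‖ ^ 2 ≤ 3 * (1 + S * b ^ 2 / (2 * δ₁ * lo₁)) * Real.exp (-(lam * (t₁ - t₀ - δ₁))) * ‖u t₀‖ ^ 2 := by
  -- positivity of the structural constants
  have hm₂0 : 0 ≤ m₂ := by rw [hm₂]; exact freqNormSq_nonneg _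
  have hRM : (0:ℝ) < (R : ℝ) - M := sub_pos.mpr hMR
  have hA : (0:ℝ) ≤ 4 * a ^ 2 := by positivity
  have hCJ : (0:ℝ) ≤ 8 * a ^ 2 * (1 + m₂) * |hi'| / lo' := by positivity
  have hlo₁0 : 0 < lo₁ := by rw [hlo₁]; positivity
  have hMo0 : 0 ≤ Mo := by rw [hMo]; positivity
  have hU₁0 : 0 < U₁ := by rw [hU₁]; positivity
  have hU₂0 : 0 < U₂ := by rw [hU₂]; positivity
  have hU₃0 : 0 < U₃ := by rw [hU₃]; positivity
  have hS' : S = 4 * (4 * a ^ 2) + 16 * (8 * a ^ 2 * (1 + m₂) * |hi'| / lo') + 1 := hS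
  -- the parameter bookkeeping (F5)
  have Q3' : 2 * (4 * (4 * a ^ 2) + 16 * (8 * a ^ 2 * (1 + m₂) * |hi'| / lo') + 1) ^ 2 * b ^ 3 * GM ^ 2 ≤ Gm * lo₁ := by rw [← hS']; exact Q3
  have Qd' : 8 * ρ * (1 + Mo) ≤ (4 * (4 * a ^ 2) + 16 * (8 * a ^ 2 * (1 + m₂) * |hi'| / lo') + 1) * q := by rw [← hS']; exact Qd
  obtain ⟨hα, hlam0, hs, hs', P1, P2, P3, P4, -, P4c, P4d, P5, P6, P7, P8⟩ :=
    LadderCrush.hypocoercive_parameters (A := 4 * a ^ 2) (CJ := 8 * a ^ 2 * (1 + m₂) * |hi'| / lo') (lo₁ := lo₁) (Gm := Gm) (GM := GM)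
      (η₀ := η₀) (ρ := ρ) (Mo := Mo) (U₁ := U₁) (U₂ := U₂) (U₃ := U₃) (b := b) (q := q)
      hA hCJ hlo₁0 hGm hMo0 hU₁0 hU₂0 hU₃0 hb hq Q3' Q4 Qc Qd'
  simp only [← hS'] at hα hlam0 P1 P2 P3 P4d P5 P6 P7 P8
  simp only [← hlam] at hlam0 P5 P6 P7 P8
  refine ⟨hlam0, ?_⟩
  -- the crush (F4h) at `α = S b²`, `β = b`, `s = b/q`, `s' = q/b`
  subst ha hm₂ hlo₁ hρ hMo hη₀ hU₁ hU₂ hU₃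
  exact ladder_crush W₁ i z₀ hhop hM hMR h𝔸 hlo' hhi hoddA hβo hγ₁ hδ hδt hu h0 hoff hG hGm.le
    (s := b / q) (s' := q / b) hs hs' (α := S * b ^ 2) (β := b) (lam := lam) (ε := ε) hα hb hlam0.le hε
    P1 P2 P3 P4 P4c P4d P5 P6 P7 P8

end Summit.AnomalousDissipation.AnomalousDissipation.Theorems.SolenoidalFractalHomogenisation.LagrangianStep.Sideband

end
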